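import Mathlib.MeasureTheory.Measure.Portmanteau
import Mathlib.MeasureTheory.Function.ConvergenceInDistribution
import Literature.Probability.RandomPlanarGeometry.SLE
import Literature.Probability.Process.KolmogorovExtensionProofs
import HarnessLib

/-!
# Perturbation glue: convergence in law to chordal SLE is stable under perturbations that are `o(1)` in probability

Crux `Summit.CriticalPhenomena.SAWScalingLimit.Theses.SAWDevelopingMap.HexTight` (stmt-CriticalPhenomena-5423,
shared verbatim with `…Theses.SAWResidueField.HexTight`), line `reversible-driving`, stub `stub_lawPerturbation`
(`= LawPerturbation` of `Cruxes/HexTight/Lines/reversible_driving.lean`).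

**Statement (`stub_lawPerturbation`).** Let `X δ, Y δ : Ωδ δ → CurveClass ℂ` be two families of random curve
classes on the same sample spaces with laws `P δ`, the laws being eventually (along `δ → 0⁺`) probability
measures and `Y δ` eventually a.e.-measurable. If `dist (X δ) (Y δ) → 0` in probability, i.e.
`P δ {ε < dist (X δ) (Y δ)} → 0` for every `ε > 0`, and `X` converges in law to chordal SLE_κ in `(D; a, b)`
(`ConvergesInLawToSLE κ D X P`), then so does `Y` (with the same SLE_κ random curve `Γ`).

**Proof ("converging together", Billingsley Thm 3.1 / Slutsky).** `TendstoLaw` is tested on bounded continuous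
functions. By Mathlib's portmanteau criterion `MeasureTheory.tendsto_iff_forall_lipschitz_integral_tendsto`
(weak convergence of probability measures along a countably generated filter is tested on bounded LIPSCHITZ
functions) it suffices — after packaging the laws of `Y δ` as probability measures on `CurveClass ℂ`, with a
junk value off the eventual good set (`tendsto_integral_comp_of_forall_lipschitz`) — to treat a bounded
`L`-Lipschitz `F` with `dist (F x) (F y) ≤ M`, for which
`|∫ F (Y δ) dP δ - ∫ F (X δ) dP δ| ≤ L ε + M · P δ {ε < dist (X δ) (Y δ)}` (`abs_integral_sub_integral_le`);
the right-hand side tends to `L ε`, and `ε > 0` is arbitrary. The pre-Wiener measure is a probability measure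
unconditionally (Kolmogorov extension, `Literature.Probability.Process.exists_isProjectiveLimit_holds`).
Models: Mathlib's `MeasureTheory.tendstoInDistribution_of_tendstoInMeasure_sub` (normed-group version on a fixed
sample space) and the tree's `Cruxes.HexTransfer.Sketch.PortTransfer.tendstoLaw_of_dist_le` (deterministic
closeness), from which the packaging step is adapted.

References: P. Billingsley, *Convergence of probability measures* (2nd ed., 1999), Thm 2.1 (portmanteau) and
Thm 3.1 (converging together) [Billingsley1999]; tagged [folklore].
-/

noncomputable section

open scoped ENNReal NNReal Topology BoundedContinuousFunction
open MeasureTheory Filter Topology Set Metric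
open Literature Literature.Probability Literature.Probability.RandomPlanarGeometry

namespace Summit.CriticalPhenomena.SAWScalingLimit.Theorems.HexTight.ReversibleDriving

/-! ### Abstract lemmas: the bounded-Lipschitz estimate and the Lipschitz-to-continuous upgrade -/

section Abstract

variable {E : Type*} [PseudoMetricSpace E] [MeasurableSpace E] [OpensMeasurableSpace E]

/-- A bounded continuous function of an a.e.-measurable random variable is integrable under a finite measure.
[folklore] -/
theorem integrable_comp_of_aemeasurable {Ω : Type*} [MeasurableSpace Ω] {μ : Measure Ω} [IsFiniteMeasure μ]
    (g : E →ᵇ ℝ) {Y : Ω → E} (hY : AEMeasurable Y μ) : Integrable (fun ω => g (Y ω)) μ :=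
  Integrable.of_bound (g.continuous.measurable.comp_aemeasurable hY).aestronglyMeasurable ‖g‖
    (ae_of_all _ fun ω => g.norm_coe_le_norm (Y ω))

/-- **The bounded-Lipschitz estimate.** For a probability measure `P`, a.e.-measurable `X Y : Ω → E` with values
in a second-countable (pseudo-)metric space, a bounded continuous `g` which is `L`-Lipschitz with
`dist (g x) (g y) ≤ M`, and `ε > 0`:
`|∫ g (Y ω) dP - ∫ g (X ω) dP| ≤ L ε + M · P {ε < dist (X ω) (Y ω)}` (split `Ω` according to whether
`dist (X ω) (Y ω) ≤ ε`). Billingsley (1999), proof of Thm 3.1. [folklore] -/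
theorem abs_integral_sub_integral_le {Ω : Type*} [MeasurableSpace Ω] [SecondCountableTopology E]
    {P : Measure Ω} [IsProbabilityMeasure P] {X Y : Ω → E} (hX : AEMeasurable X P) (hY : AEMeasurable Y P)
    (g : E →ᵇ ℝ) {M : ℝ} {L : ℝ≥0} (hM : ∀ x y, dist (g x) (g y) ≤ M) (hL : LipschitzWith L g) {ε : ℝ}
    (hε : 0 < ε) :
    |(∫ ω, g (Y ω) ∂P) - ∫ ω, g (X ω) ∂P| ≤ L * ε + M * P.real {ω | ε < dist (X ω) (Y ω)} := by
  -- adapted from Mathlib `MeasureTheory.tendstoInDistribution_of_tendstoInMeasure_sub` (the estimate `h_le`)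
  have h_int_Y : Integrable (fun ω => g (Y ω)) P := integrable_comp_of_aemeasurable g hY
  have h_int_X : Integrable (fun ω => g (X ω)) P := integrable_comp_of_aemeasurable g hX
  have h_int_sub : Integrable (fun ω => ‖g (Y ω) - g (X ω)‖) P := (h_int_Y.sub h_int_X).norm
  have hS : NullMeasurableSet {ω | ε < dist (X ω) (Y ω)} P :=
    _root_.nullMeasurableSet_lt aemeasurable_const (hX.dist hY)
  rw [← integral_sub h_int_Y h_int_X, ← Real.norm_eq_abs]
  calc ‖∫ ω, (g (Y ω) - g (X ω)) ∂P‖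
      ≤ ∫ ω, ‖g (Y ω) - g (X ω)‖ ∂P := norm_integral_le_integral_norm _
    _ = (∫ ω in {ω | ε < dist (X ω) (Y ω)}, ‖g (Y ω) - g (X ω)‖ ∂P) +
          ∫ ω in {ω | ε < dist (X ω) (Y ω)}ᶜ, ‖g (Y ω) - g (X ω)‖ ∂P :=
      (integral_add_compl₀ hS h_int_sub).symm
    _ ≤ (∫ _ in {ω | ε < dist (X ω) (Y ω)}, M ∂P) +
          ∫ _ in {ω | ε < dist (X ω) (Y ω)}ᶜ, (L : ℝ) * ε ∂P := by
      gcongr ?_ + ?_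
      · exact setIntegral_mono h_int_sub.integrableOn integrableOn_const fun ω => by
          change ‖g (Y ω) - g (X ω)‖ ≤ M
          rw [← dist_eq_norm]
          exact hM _ _
      · refine setIntegral_mono_on₀ h_int_sub.integrableOn integrableOn_const hS.compl ?_
        intro ω hω
        have hω' : dist (Y ω) (X ω) ≤ ε := by
          rw [dist_comm]
          exact not_lt.1 hω
        rw [← dist_eq_norm]
        calc dist (g (Y ω)) (g (X ω)) ≤ L * dist (Y ω) (X ω) := hL.dist_le_mul _ _
          _ ≤ L * ε := by gcongr
    _ = M * P.real {ω | ε < dist (X ω) (Y ω)} + L * ε * P.real {ω | ε < dist (X ω) (Y ω)}ᶜ := by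
      rw [setIntegral_const, setIntegral_const, smul_eq_mul, smul_eq_mul]
      ring
    _ ≤ M * P.real {ω | ε < dist (X ω) (Y ω)} + L * ε * 1 := by
      gcongr
      exact measureReal_le_one
    _ = L * ε + M * P.real {ω | ε < dist (X ω) (Y ω)} := by ring

/-- **From bounded Lipschitz to bounded continuous test functions (eventual hypotheses).** Let `l` be a
countably generated filter, `P i` eventually probability measures, `Y i : Ω i → E` eventually a.e.-measurable,
`ν` a probability measure on the (pseudo-)metric space `E`. If `∫ F (Y i) dP i → ∫ F dν` along `l` for every
bounded Lipschitz `F`, then the same holds for every bounded continuous `g`: package the laws of `Y i` as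
probability measures on `E` (junk value `ν` off the good set) and apply Mathlib's portmanteau criterion
`MeasureTheory.tendsto_iff_forall_lipschitz_integral_tendsto`. Billingsley (1999), Thm 2.1. [folklore] -/
theorem tendsto_integral_comp_of_forall_lipschitz {ι : Type*} {l : Filter ι} [l.IsCountablyGenerated]
    {Ω : ι → Type*} [∀ i, MeasurableSpace (Ω i)] {P : ∀ i, Measure (Ω i)} {Y : ∀ i, Ω i → E}
    (hP : ∀ᶠ i in l, IsProbabilityMeasure (P i)) (hY : ∀ᶠ i in l, AEMeasurable (Y i) (P i))
    (ν : Measure E) [IsProbabilityMeasure ν]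
    (h : ∀ F : E → ℝ, (∃ C, ∀ x y, dist (F x) (F y) ≤ C) → (∃ L, LipschitzWith L F) →
      Tendsto (fun i => ∫ ω, F (Y i ω) ∂P i) l (𝓝 (∫ x, F x ∂ν)))
    (g : E →ᵇ ℝ) : Tendsto (fun i => ∫ ω, g (Y i ω) ∂P i) l (𝓝 (∫ x, g x ∂ν)) := by
  -- adapted from `Cruxes.HexTransfer.Sketch.PortTransfer.tendstoLaw_of_dist_le` (packaging steps 3–5)
  classical
  let ν' : ProbabilityMeasure E := ⟨ν, inferInstance⟩
  let νs : ι → ProbabilityMeasure E := fun i =>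
    if hi : IsProbabilityMeasure (P i) ∧ AEMeasurable (Y i) (P i) then
      ⟨(P i).map (Y i), by haveI := hi.1; exact Measure.isProbabilityMeasure_map hi.2⟩
    else ν'
  have hνs : ∀ᶠ i in l, ∀ G : E → ℝ, Continuous G →
      ∫ x, G x ∂(νs i : Measure E) = ∫ ω, G (Y i ω) ∂P i := by
    filter_upwards [hP, hY] with i hPi hYi G hG
    simp only [νs, dif_pos (And.intro hPi hYi), ProbabilityMeasure.coe_mk]
    exact integral_map hYi hG.aestronglyMeasurable
  have hT : Tendsto νs l (𝓝 ν') := by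
    rw [tendsto_iff_forall_lipschitz_integral_tendsto]
    intro F hFb hFL
    have hF : Continuous F := hFL.choose_spec.continuous
    exact (h F hFb hFL).congr' (hνs.mono fun i hi => (hi F hF).symm)
  have hg := (ProbabilityMeasure.tendsto_iff_forall_integral_tendsto.1 hT) g
  exact hg.congr' (hνs.mono fun i hi => hi g g.continuous)

end Abstract

/-! ### The stub -/

/-- **PERTURBATION GLUE** (`= LawPerturbation` of the line `reversible-driving` of the crux `HexTight`):
convergence in law to chordal SLE_κ along the mesh filter `𝓝[>] 0` passes from `X δ` to any `Y δ` with
`dist (X δ) (Y δ) → 0` in probability, the laws `P δ` being eventually probability measures and `Y δ` eventually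
a.e.-measurable. Proof: same SLE_κ random curve `Γ`; bounded continuous test functions are reduced to bounded
Lipschitz ones (`tendsto_integral_comp_of_forall_lipschitz`), for which
`|∫ F (Y δ) - ∫ F (X δ)| ≤ L ε + M · P δ {ε < dist (X δ) (Y δ)} → L ε` (`abs_integral_sub_integral_le`).
Billingsley (1999), Thm 3.1 ("converging together"). [folklore] -/
theorem stub_lawPerturbation :
    ∀ (κ : ℝ≥0) (D : DobrushinDomain) (Ωδ : ℝ → Type) [∀ δ, MeasurableSpace (Ωδ δ)]
    (X Y : (δ : ℝ) → Ωδ δ → CurveClass ℂ) (P : (δ : ℝ) → Measure (Ωδ δ)),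
    (∀ᶠ δ : ℝ in 𝓝[>] (0 : ℝ), IsProbabilityMeasure (P δ)) →
    (∀ᶠ δ : ℝ in 𝓝[>] (0 : ℝ), AEMeasurable (Y δ) (P δ)) →
    (∀ ε : ℝ, 0 < ε →
      Tendsto (fun δ : ℝ => P δ {ω | ε < dist (X δ ω) (Y δ ω)}) (𝓝[>] (0 : ℝ)) (𝓝 0)) →
    ConvergesInLawToSLE κ D X P → ConvergesInLawToSLE κ D Y P := by
  intro κ D Ωδ _ X Y P hP hY hXY hX
  obtain ⟨Γ, hΓ, hXm, hT⟩ := hX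
  refine ⟨Γ, hΓ, hY, ?_⟩
  haveI : IsProbabilityMeasure Process.preWienerMeasure :=
    Process.isProbabilityMeasure_preWienerMeasure
      (Process.isProjectiveLimit_preWienerMeasure_of Process.exists_isProjectiveLimit_holds)
  have hΓm : AEMeasurable Γ Process.preWienerMeasure := hΓ.aemeasurable
  haveI : IsProbabilityMeasure (Process.preWienerMeasure.map Γ) := Measure.isProbabilityMeasure_map hΓm
  have hmap : ∀ G : CurveClass ℂ → ℝ, Continuous G →
      ∫ x, G x ∂(Process.preWienerMeasure.map Γ) = ∫ ω, G (Γ ω) ∂Process.preWienerMeasure :=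
    fun G hG => integral_map hΓm hG.aestronglyMeasurable
  intro g
  rw [← hmap g g.continuous]
  refine tendsto_integral_comp_of_forall_lipschitz hP hY (Process.preWienerMeasure.map Γ) ?_ g
  rintro F ⟨M, hM⟩ ⟨L, hL⟩
  rw [hmap F hL.continuous]
  -- `F` as a bounded continuous function, `(L + 1)`-Lipschitz
  let G : CurveClass ℂ →ᵇ ℝ := ⟨⟨F, hL.continuous⟩, ⟨M, hM⟩⟩
  have hL' : LipschitzWith (L + 1) G := hL.weaken (by simp)
  have hTX : Tendsto (fun δ => ∫ ω, F (X δ ω) ∂P δ) (𝓝[>] 0)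
      (𝓝 (∫ ω, F (Γ ω) ∂Process.preWienerMeasure)) := hT G
  -- the difference of the two integrals tends to `0`
  have hdiff : Tendsto (fun δ => (∫ ω, F (Y δ ω) ∂P δ) - ∫ ω, F (X δ ω) ∂P δ) (𝓝[>] 0) (𝓝 0) := by
    rw [Metric.tendsto_nhds]
    intro η hη
    have hL1 : (0 : ℝ) < (L : ℝ) + 1 := by positivity
    obtain ⟨ε, hε, hεη⟩ : ∃ ε : ℝ, 0 < ε ∧ ((L + 1 : ℝ≥0) : ℝ) * ε < η := by
      refine ⟨η / (2 * ((L : ℝ) + 1)), by positivity, ?_⟩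
      calc ((L + 1 : ℝ≥0) : ℝ) * (η / (2 * ((L : ℝ) + 1))) = η / 2 := by
            push_cast
            field_simp
        _ < η := half_lt_self hη
    have hbound : Tendsto
        (fun δ => ((L + 1 : ℝ≥0) : ℝ) * ε + M * (P δ).real {ω | ε < dist (X δ ω) (Y δ ω)})
        (𝓝[>] 0) (𝓝 (((L + 1 : ℝ≥0) : ℝ) * ε + M * 0)) := by
      refine tendsto_const_nhds.add (Tendsto.const_mul M ?_)
      have h0 := (ENNReal.tendsto_toReal ENNReal.zero_ne_top).comp (hXY ε hε)
      rw [ENNReal.toReal_zero] at h0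
      exact h0
    have hlt : ((L + 1 : ℝ≥0) : ℝ) * ε + M * 0 < η := by rwa [mul_zero, add_zero]
    filter_upwards [hbound.eventually_lt_const hlt, hP, hY, hXm] with δ hδ hPδ hYδ hXδ
    rw [dist_zero_right, Real.norm_eq_abs]
    exact (abs_integral_sub_integral_le hXδ hYδ G hM hL' hε).trans_lt hδ
  have key := hTX.add hdiff
  rw [add_zero] at key
  exact key.congr fun δ => by ring

end Summit.CriticalPhenomena.SAWScalingLimit.Theorems.HexTight.ReversibleDriving

end
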